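import Summits.Ventures.Crystal3D.Theorems.StickyWulffConstantTextureLiminfRunEndLedger
import HarnessLib

/-!
# The run-end ledger of lane T, MIXED variant (a)+(c) (route `StickyWulffConstant`; helper for the crux `TextureLiminf`,
# stmt-Ventures-19483; cf-p1 ROUTE §85(7) DECISION (xxx): «u_T ≥ 0.975 ⇔ s_T ≤ 2 with variant (a) or (c), or s_T = 0»)

HONEST FRAMING. Part of the venture `Summits/Ventures/Crystal3D` (cell `crystal3d-full`), helper for the crux
`TextureLiminf` (stmt-Ventures-19483).  Rung credit only; bookkeeping in the kernel.  Companion of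
`…TextureLiminfRunEndLedger` (p618175: model M `2·#E ≤ (s+2)·#P`, variant (a), variant (c)).  The census (lit's LT unit,
fields E4 = payer degree, E5 = «is the payer itself a run-end») reports PER PAYER; the natural consumer is therefore the
DISJUNCTION per shared payer — «not a run-end of `E` OR at most ten contacts» — which still gives full charge at `s ≤ 2`:
* `abstract_ledger_variantAC` — ends `E`, payers `P`, weight `w ≥ 1`, shared payers «∉ E ∨ w ≥ 2», sharing `s ≤ 2`
  ⇒ `#E ≤ Σ_P w` (the ends that are payers avoid the shared non-ends; shared ends weigh 2);
* `hcpRunEnd_ledger_variantAC` — the hcp instantiation through (L7): `#E ≤ Σ_{z ∈ P} (12 − deg z)` modulo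
  `KissingGap δ`, `KissingClassification δ`, `hshare s` (`s ≤ 2`) and the mixed per-payer hypothesis.
WHAT THIS IS NOT: a bound on `s`; F-C1 not moved.
-/

noncomputable section

namespace Summit.Ventures.Crystal3D.Theorems

open Summit.Ventures.Crystal3D Finset
open scoped InnerProductSpace

variable {X : Finset (EuclideanSpace ℝ (Fin 3))}
/-! ### The mixed variant (a)+(c): per shared payer, «not an end OR deficiency ≥ 2» -/

/-- **Mixed variant (a)+(c), abstract.**  With a weight `w ≥ 1` on payers, if every SHARED payer (one related to a
non-payer end) is either not an end or has weight `≥ 2`, then at sharing `s ≤ 2`: `#E ≤ Σ_{p ∈ P} w p`.  (Variant (a) is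
the case «never an end», variant (c) the case «always weight ≥ 2»; a census reports the disjunction per payer.) -/
theorem abstract_ledger_variantAC {α : Type*} [DecidableEq α] (E P : Finset α) (r : α → α → Prop)
    [∀ a b, Decidable (r a b)] {s : ℕ} (hs : s ≤ 2) (w : α → ℕ)
    (htwo : ∀ e ∈ E \ P, 2 ≤ (P.filter fun p => r e p).card)
    (hshare : ∀ p ∈ P, ((E \ P).filter fun e => r e p).card ≤ s)
    (hw1 : ∀ p ∈ P, 1 ≤ w p) (hmix : ∀ p ∈ P, ∀ e ∈ E \ P, r e p → p ∉ E ∨ 2 ≤ w p) :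
    E.card ≤ ∑ p ∈ P, w p := by
  set P₂ := P.filter fun p => ∃ e ∈ E \ P, r e p with hP₂
  have hsub : P₂ ⊆ P := Finset.filter_subset _ _
  -- shared payers split: `A` = not ends, `B` = ends (hence weight ≥ 2)
  set B := P₂.filter fun p => p ∈ E with hB
  set A := P₂.filter fun p => p ∉ E with hA
  have hAB : A.card + B.card = P₂.card := by
    rw [hA, hB, add_comm]; exact Finset.card_filter_add_card_filter_not _
  have hsplit : E.card = (E ∩ P).card + (E \ P).card := (Finset.card_inter_add_card_sdiff E P).symm
  -- ends that are payers: inside `(P \ P₂) ∪ B`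
  have h1 : (E ∩ P).card ≤ (P \ P₂).card + B.card := by
    calc (E ∩ P).card ≤ ((P \ P₂) ∪ B).card := Finset.card_le_card (by
          intro p hp
          obtain ⟨hpE, hpP⟩ := Finset.mem_inter.mp hp
          by_cases h2 : p ∈ P₂
          · exact Finset.mem_union_right _ (Finset.mem_filter.mpr ⟨h2, hpE⟩)
          · exact Finset.mem_union_left _ (Finset.mem_sdiff.mpr ⟨hpP, h2⟩))
      _ ≤ (P \ P₂).card + B.card := Finset.card_union_le _ _
  -- double counting against the shared payers
  have htwo' : ∀ e ∈ E \ P, 2 ≤ (P₂.filter fun p => r e p).card := by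
    intro e he
    refine le_trans (htwo e he) (Finset.card_le_card ?_)
    intro p hp
    obtain ⟨hpP, hre⟩ := Finset.mem_filter.mp hp
    exact Finset.mem_filter.mpr ⟨Finset.mem_filter.mpr ⟨hpP, e, he, hre⟩, hre⟩
  have hshare' : ∀ p ∈ P₂, ((E \ P).filter fun e => r e p).card ≤ s :=
    fun p hp => hshare p (Finset.mem_filter.mp hp).1
  have h2 : (E \ P).card * 2 ≤ P₂.card * s := Finset.card_mul_le_card_mul (r := r) htwo' hshare'
  -- weights: `w ≥ 1` on `P \ P₂` and on `A`, `w ≥ 2` on `B`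
  have hP : (P \ P₂).card + P₂.card = P.card := Finset.card_sdiff_add_card_eq_card hsub
  have hsum : ∑ p ∈ P, w p = ∑ p ∈ P \ P₂, w p + ∑ p ∈ P₂, w p := (Finset.sum_sdiff hsub).symm
  have hsum2 : ∑ p ∈ P₂, w p = ∑ p ∈ A, w p + ∑ p ∈ B, w p := by
    rw [hA, hB, add_comm]; exact (Finset.sum_filter_add_sum_filter_not _ _ _).symm
  have hs1 : (P \ P₂).card ≤ ∑ p ∈ P \ P₂, w p := by
    rw [Finset.card_eq_sum_ones]; exact Finset.sum_le_sum fun p hp => hw1 p (Finset.mem_sdiff.mp hp).1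
  have hsA : A.card ≤ ∑ p ∈ A, w p := by
    rw [Finset.card_eq_sum_ones]
    exact Finset.sum_le_sum fun p hp => hw1 p (hsub (Finset.mem_filter.mp hp).1)
  have hsB : 2 * B.card ≤ ∑ p ∈ B, w p := by
    rw [Finset.card_eq_sum_ones, Finset.mul_sum]
    refine Finset.sum_le_sum fun p hp => ?_
    obtain ⟨hp2, hpE⟩ := Finset.mem_filter.mp hp
    obtain ⟨hpP, e, he, hre⟩ := Finset.mem_filter.mp hp2
    rcases hmix p hpP e he hre with h | h
    · exact absurd hpE h
    · simpa using h
  have h3 : P₂.card * s ≤ P₂.card * 2 := Nat.mul_le_mul_left _ hs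
  omega

/-- **THE RUN-END LEDGER, MIXED VARIANT (a)+(c)** (`u_T = 1`): if `s ≤ 2` and every unsaturated ball touching a
saturated run-end of `E` is EITHER not itself a run-end of `E` (census field E5) OR has at most ten contacts (field E4),
then `#E ≤ Σ_{z ∈ P} (12 − deg z)`. -/
theorem hcpRunEnd_ledger_variantAC {δ : ℝ} (hg : KissingGap δ) (hc : KissingClassification δ)
    (hX : ∀ p ∈ X, ∀ q ∈ X, p ≠ q → 1 ≤ dist p q) {deg : EuclideanSpace ℝ (Fin 3) → ℕ}
    (hdeg : ∀ z, deg z = (X.filter fun q => dist z q = 1).card)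
    {E P : Finset (EuclideanSpace ℝ (Fin 3))} (hEX : E ⊆ X)
    (hrun : ∀ t ∈ E, ∃ A : EuclideanSpace ℝ (Fin 3) ≃ₗᵢ[ℝ] EuclideanSpace ℝ (Fin 3),
      t + A (slotSite 2) ∈ X ∧ t + A (slotSite 6) ∈ X ∧ t + A (slotSite 8) ∈ X ∧
      t + A ((1 / 3 : ℝ) • slotSite 8 - (2 / 3 : ℝ) • slotSite 0 - (2 / 3 : ℝ) • slotSite 4) ∈ X ∧
      t + A (slotSite 1) ∉ X)
    (hP : P = X.filter fun z => deg z ≤ 11 ∧ (z ∈ E ∨ ∃ t ∈ E, deg t = 12 ∧ dist t z = 1))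
    {s : ℕ} (hs : s ≤ 2)
    (hshare : ∀ z ∈ X, deg z ≤ 11 → (E.filter fun t => deg t = 12 ∧ dist t z = 1).card ≤ s)
    (hmix : ∀ z ∈ X, deg z ≤ 11 → (∃ t ∈ E, deg t = 12 ∧ dist t z = 1) → z ∉ E ∨ deg z ≤ 10) :
    E.card ≤ ∑ z ∈ P, (12 - deg z) := by
  refine abstract_ledger_variantAC E P (fun t z => dist t z = 1) hs (fun z => 12 - deg z) ?_ ?_ ?_ ?_
  · intro t ht
    obtain ⟨A, haX, hbX, hcX, hdX, hemp⟩ := hrun t (Finset.mem_sdiff.mp ht).1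
    exact two_le_card_payers_of_saturated_runEnd hg hc hX hdeg hP (Finset.mem_sdiff.mp ht).1 A haX hbX
      hcX hdX hemp (deg_eq_twelve_of_mem_sdiff_payers hX hdeg hEX hP ht)
  · intro z hz
    have hz' := hz
    rw [hP] at hz'
    obtain ⟨hzX, hdg, -⟩ := Finset.mem_filter.mp hz'
    refine le_trans (Finset.card_le_card fun t ht => ?_) (hshare z hzX hdg)
    obtain ⟨ht, hd⟩ := Finset.mem_filter.mp ht
    exact Finset.mem_filter.mpr
      ⟨(Finset.mem_sdiff.mp ht).1, deg_eq_twelve_of_mem_sdiff_payers hX hdeg hEX hP ht, hd⟩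
  · intro z hz
    rw [hP] at hz
    have := (Finset.mem_filter.mp hz).2.1
    omega
  · intro z hz t ht hd
    have hz' := hz
    rw [hP] at hz'
    obtain ⟨hzX, hdg, -⟩ := Finset.mem_filter.mp hz'
    rcases hmix z hzX hdg ⟨t, (Finset.mem_sdiff.mp ht).1, deg_eq_twelve_of_mem_sdiff_payers hX hdeg hEX hP ht, hd⟩
      with h | h
    · exact Or.inl h
    · right; omega


/-! ### Appended after lit's LT census (2026-08-28T11:35Z): the DEFICIENCY-WEIGHTED ledger (D) — no sharing number at all -/

/-- **Deficiency-weighted ledger, abstract.**  If every payer's weight covers the number of non-payer ends it is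
related to, plus one if it is itself an end, then `#E ≤ Σ_{p ∈ P} w p` — whatever the sharing.  (Each non-payer end is
sent to one of its payers; the fibres are paid by the weights.) -/
theorem abstract_ledger_weighted {α : Type*} [DecidableEq α] (E P : Finset α) (r : α → α → Prop)
    [∀ a b, Decidable (r a b)] (w : α → ℕ)
    (hone : ∀ e ∈ E \ P, 1 ≤ (P.filter fun p => r e p).card)
    (hw : ∀ p ∈ P, ((E \ P).filter fun e => r e p).card + (if p ∈ E then 1 else 0) ≤ w p) :
    E.card ≤ ∑ p ∈ P, w p := by
  have hsplit : E.card = (E ∩ P).card + (E \ P).card := (Finset.card_inter_add_card_sdiff E P).symm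
  -- double count the incidences (non-payer end, payer): each such end has ≥ 1, each payer has its fibre
  have h2 : (E \ P).card * 1 ≤ ∑ p ∈ P, ((E \ P).filter fun e => r e p).card := by
    calc (E \ P).card * 1 ≤ ∑ e ∈ E \ P, (P.filter fun p => r e p).card := by
          rw [Finset.card_eq_sum_ones, Finset.sum_mul]; simp only [one_mul]
          exact Finset.sum_le_sum fun e he => hone e he
      _ = ∑ p ∈ P, ((E \ P).filter fun e => r e p).card :=
          Finset.sum_card_bipartiteAbove_eq_sum_card_bipartiteBelow _
  have h3 : (E ∩ P).card = ∑ p ∈ P, (if p ∈ E then 1 else 0) := by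
    rw [Finset.sum_ite_mem, Finset.inter_comm, Finset.card_eq_sum_ones]
  have h4 : ∑ p ∈ P, (((E \ P).filter fun e => r e p).card + (if p ∈ E then 1 else 0)) ≤ ∑ p ∈ P, w p :=
    Finset.sum_le_sum fun p hp => hw p hp
  rw [Finset.sum_add_distrib] at h4
  omega

/-- **THE RUN-END LEDGER, DEFICIENCY-WEIGHTED FORM (D)** (`u_T = 1`, no sharing number): if every unsaturated ball `z`
that is a run-end of `E` or touches a saturated run-end of `E` has
`12 − deg z ≥ #{saturated run-ends of E touching z} + [z ∈ E]`, then `#E ≤ Σ_{z ∈ P} (12 − deg z)`.  This is the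
hypothesis lit's free census supports at the LT level (k = 2 units served by a deficiency-1 payer: 0/616; by a
deficiency-2 payer: feasible; k = 3 only with deficiency 9), modulo the pending same-grain census. -/
theorem hcpRunEnd_ledger_weighted {δ : ℝ} (hg : KissingGap δ) (hc : KissingClassification δ)
    (hX : ∀ p ∈ X, ∀ q ∈ X, p ≠ q → 1 ≤ dist p q) {deg : EuclideanSpace ℝ (Fin 3) → ℕ}
    (hdeg : ∀ z, deg z = (X.filter fun q => dist z q = 1).card)
    {E P : Finset (EuclideanSpace ℝ (Fin 3))} (hEX : E ⊆ X)
    (hrun : ∀ t ∈ E, ∃ A : EuclideanSpace ℝ (Fin 3) ≃ₗᵢ[ℝ] EuclideanSpace ℝ (Fin 3),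
      t + A (slotSite 2) ∈ X ∧ t + A (slotSite 6) ∈ X ∧ t + A (slotSite 8) ∈ X ∧
      t + A ((1 / 3 : ℝ) • slotSite 8 - (2 / 3 : ℝ) • slotSite 0 - (2 / 3 : ℝ) • slotSite 4) ∈ X ∧
      t + A (slotSite 1) ∉ X)
    (hP : P = X.filter fun z => deg z ≤ 11 ∧ (z ∈ E ∨ ∃ t ∈ E, deg t = 12 ∧ dist t z = 1))
    (hD : ∀ z ∈ P, (E.filter fun t => deg t = 12 ∧ dist t z = 1).card + (if z ∈ E then 1 else 0) ≤ 12 - deg z) :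
    E.card ≤ ∑ z ∈ P, (12 - deg z) := by
  refine abstract_ledger_weighted E P (fun t z => dist t z = 1) (fun z => 12 - deg z) ?_ ?_
  · intro t ht
    obtain ⟨A, haX, hbX, hcX, hdX, hemp⟩ := hrun t (Finset.mem_sdiff.mp ht).1
    have h2 := two_le_card_payers_of_saturated_runEnd hg hc hX hdeg hP (Finset.mem_sdiff.mp ht).1 A haX hbX
      hcX hdX hemp (deg_eq_twelve_of_mem_sdiff_payers hX hdeg hEX hP ht)
    omega
  · intro z hz
    refine le_trans ?_ (hD z hz)
    refine Nat.add_le_add_right (Finset.card_le_card fun t ht => ?_) _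
    obtain ⟨ht, hd⟩ := Finset.mem_filter.mp ht
    exact Finset.mem_filter.mpr
      ⟨(Finset.mem_sdiff.mp ht).1, deg_eq_twelve_of_mem_sdiff_payers hX hdeg hEX hP ht, hd⟩

end Summit.Ventures.Crystal3D.Theorems

end
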